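import Summits.BirchSwinnertonDyer.Rank1Residual.F1Sign2.OddTamagawaSpinLawAtTwo
import HarnessLib

/-!
# DESC-38 kernel — REF1-AUDIT §246's BC7 certificates a–b for `F1Sign2/OddTamagawaSpinLawAtTwo.lean` (`REF1-data/b246/Probe246.lean` 9860375b038b68ea l.103–111; REF1's two
# `example`s named as theorems by the typer, statements and proofs VERBATIM) (typer -ty g20)

CONTENT (all PROVED, no `sorry`, no new `def`): BC7-a `pureLaw_of_oddTamagawa` — DESC-38-A ⟹ the DESC-37-B-shaped conclusion needs NO 2-adic datum (instantiate at an arbitrary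
curve); BC7-b `odd_finprod_of_infinite_mulSupport` — junk guard: WITHOUT finiteness of the support `finprod` is `1`, which is odd, so the typed hypothesis `Odd W.tamagawaProduct`
would then be satisfied for free (polarity: makes DESC-38-A STRONGER, not vacuous; -desc's glue `odd_tamagawaNumberAt_of_odd_tamagawaProduct` carries the finiteness hypothesis).
BSD is not proved by this; 23715 is not closed by this.
-/

noncomputable section

open scoped Classical

open WeierstrassCurve Literature.NumberTheory.EllipticCurves Polynomial IsDedekindDomain NumberField
open Summit.BirchSwinnertonDyer.Rank1Residual.F1Sign2

namespace Summit.BirchSwinnertonDyer.Rank1Residual.F1Sign2.OddTamagawaSpinLaw.Kernel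

/-- BC7-a (REF1 §246): DESC-38-A ⟹ the DESC-37-B-shaped conclusion needs NO 2-adic datum — instantiate at an arbitrary curve. -/
theorem pureLaw_of_oddTamagawa (h : PureSpinLawOfOddTamagawaAtTwo) (W : WeierstrassCurve ℚ) [W.IsElliptic] [W.IsGloballyMinimal]
    (c xnum : Polynomial ℤ) (xden : ℕ) (hc : CubicDatumFor W c xnum xden) (hs : selmerTwoCard W = 1)
    (ho : DegOnePrimesOddClassC c) (ht : Odd W.tamagawaProduct) : CorrectedSpinLawFits W c xnum xden [] :=
  h W c xnum xden hc hs ho ht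

/-- BC7-b (REF1 §246; junk guard): WITHOUT finiteness of the support a `finprod` over `ℕ` is `1`, which is odd — so `Odd W.tamagawaProduct` would be
satisfied for free if `mulSupport (W.tamagawaNumberAt ·)` were infinite (it is not: `c_v = 1` at good places); polarity: DESC-38-A gets STRONGER, not vacuous. -/
theorem odd_finprod_of_infinite_mulSupport (f : ℕ → ℕ) (hf : ¬ (Function.mulSupport f).Finite) : Odd (∏ᶠ i, f i) := by
  rw [finprod_of_infinite_mulSupport hf]; exact odd_one

end Summit.BirchSwinnertonDyer.Rank1Residual.F1Sign2.OddTamagawaSpinLaw.Kernel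

end
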